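import Mathlib.Topology.Algebra.Category.ProfiniteGrp.Basic
import Mathlib.Topology.Algebra.ClopenNhdofOne
import Mathlib.Topology.Maps.Proper.Basic
import Literature.AnabelianGeometry.SemiGraphs.OuterSemidirectProductTopology
import Literature.AnabelianGeometry.SemiGraphs.CharacteristicOpenCore
import Literature.AnabelianGeometry.SemiGraphs.ArithOuterActionCongruenceFinite
import HarnessLib

/-!
# [SemiAnbd] §0 p. 5: the outer semi-direct product `G ⋊^out J` of a COMPACT `G` is compact —
# profiniteness of `G ⋊^out J` along invariant levels (proofs)

Mochizuki, *Semi-graphs of anabelioids*, Publ. RIMS **42** (2006) 221–322, §0 "Topological Groups"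
p. 5 (`G ⋊^out J := Aut(G) ×_{Out(G)} J`, "a natural exact sequence `1 → G → G ⋊^out J → J → 1`")
[cite: MochizukiSemiAnbd2006, §0 p.5]; Dixon–du Sautoy–Mann–Segal, *Analytic pro-p groups*, §5.2
(congruence topology on `Aut(G)`), Thm 5.3 (`Aut(G)` profinite for `G` finitely generated)
[cite: DixonEtAl1999, §5.2].

PROOF-ONLY companion (no definitions, no named facts; abc-iut cell, layer L3, GAP row «G-P13-GR»,
holder abc-iut-w5-d151 — this file is a SUPPORT of that row by abc-iut-L3-d5; consumer [AbsTopII]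
Def 1.2 (ii) `Π_H = Π_𝔾 ⋊^out H`, `AbsoluteAnabelian.DPSCData.PiH : ProfiniteGrp`) of abc-iut-w5-d151's
GENERIC layer `outerSemidirectProduct.topology ρ N hdir hinv` (`OuterSemidirectProductTopology.lean`:
the group topology of `E := G ⋊^out_ρ J` along a directed, outer-invariant family of levels
`N : ι → Subgroup G`).  PROVED here, for that topology:

* GENERIC LEVELS, `G` COMPACT: `ι : G → E` is a CLOSED EMBEDDING (continuous by
  `continuous_toOuterSemidirectProduct`, injective for centre-free `G`, compact source, Hausdorff target:
  `isClosedEmbedding_toOuterSemidirectProduct_of_compact`); `ker aug = ι(G)` is compact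
  (`isCompact_ker`); under the continuity of the outer action along the levels (`hcont`, the hypothesis
  of `isOpenMap_snd_of_levels`) the open surjection `aug : E → J` is CLOSED — saturate a closed set by
  the compact kernel (`isClosedMap_snd_of_levels`) — hence PROPER (`isProperMap_snd_of_levels`), so
  **`E = aug⁻¹(J)` is COMPACT when `J` is** (`compactSpace_of_levels`): no inverse limits and no
  completeness of `Aut(G)` are needed; and `E` is TOTALLY DISCONNECTED when `J` is profinite and the
  levels separate points (`totallyDisconnectedSpace_of`: the level sets at open subgroups of `J` are
  clopen subgroups);
* THE CHARACTERISTIC LEVELS `N d := charOpenCore G d` (abc-iut-w4-d053's `CharacteristicOpenCore`) of a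
  PROFINITE, TOPOLOGICALLY FINITELY GENERATED `G`: directed (`charOpenCore_directed`), outer-invariant
  (`charOpenCore_outerInvariant`), open (`charOpenCore_mem_nhds_one`) and cofinal
  (`exists_charOpenCore_subset`); `hcont` HOLDS as soon as every finite-index subgroup of `J` is open
  (`levels_continuous_of_finiteIndex_isOpen`, via abc-iut-L3-d2's `TemperedExtension.exists_congruence_ker`:
  the congruence set at a finite characteristic level is the kernel of `J → Out(G ⧸ K)`), e.g. `J`
  topologically finitely generated profinite (Nikolov–Segal); SUMMARY `exists_profinite_topology`:
  for `G` profinite tfg centre-free, `J` profinite, `ρ` continuous along the characteristic levels,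
  `G ⋊^out J` carries a PROFINITE group topology making `1 → G → G ⋊^out J → J → 1` an exact sequence
  of profinite groups (`ι` closed embedding, `aug` continuous open surjective) — the input of the
  `ProfiniteGrp` packaging;
* NECESSITY of `hcont` (`levels_continuous_of_compactSpace`, generic levels): if the level topology is
  compact and `J` is Hausdorff the outer action IS continuous along the levels (`aug` is then a closed,
  hence quotient, hence open homomorphism); so `hcont` is exactly the condition for profiniteness.

Nothing here refers to the IUT corpus; no side is taken on [IUTchIII] Cor 3.12; typed ≠ proved.
-/

namespace Literature.AnabelianGeometry.SemiGraphs

namespace outerSemidirectProduct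

open Literature.AnabelianGeometry.EtaleTheta Literature.AnabelianGeometry.AbsoluteAnabelian
open Filter Topology
open scoped Pointwise

universe u v w

/-! ### Two lemmas on homomorphisms with compact kernel -/

section Kernel

variable {E : Type u} [Group E] {A : Type v} [Group A]

/-- The fibres of a homomorphism are translates of its kernel. [cite: MochizukiSemiAnbd2006, §0 p.5] -/
private theorem preimage_singleton_eq_image_ker (f : E →* A) {x : E} {a : A} (hx : f x = a) :
    f ⁻¹' {a} = (fun y => x * y) '' (f.ker : Set E) := by
  ext y
  constructor
  · intro hy
    refine ⟨x⁻¹ * y, ?_, by group⟩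
    rw [SetLike.mem_coe, MonoidHom.mem_ker, map_mul, map_inv, hx, Set.mem_singleton_iff.mp hy,
      inv_mul_cancel]
  · rintro ⟨k, hk, rfl⟩
    rw [Set.mem_preimage, map_mul, hx, (MonoidHom.mem_ker).mp hk, mul_one, Set.mem_singleton_iff]

/-- A surjective OPEN homomorphism of topological groups with COMPACT kernel is a CLOSED map: the
saturation `C · ker` of a closed set `C` is closed, and the complement of `f(C)` is the image of its
(open) complement. [cite: MochizukiSemiAnbd2006, §0 p.5] -/
private theorem isClosedMap_of_isOpenMap_of_isCompact_ker [TopologicalSpace E] [IsTopologicalGroup E]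
    [TopologicalSpace A] (f : E →* A) (hsurj : Function.Surjective f) (hopen : IsOpenMap f)
    (hker : IsCompact (f.ker : Set E)) : IsClosedMap f := by
  intro C hC
  have hS : IsClosed (C * (f.ker : Set E)) := hC.mul_right_of_isCompact hker
  have heq : (f '' C)ᶜ = f '' (C * (f.ker : Set E))ᶜ := by
    ext a
    constructor
    · intro ha
      obtain ⟨x, rfl⟩ := hsurj a
      refine ⟨x, fun hx => ha ?_, rfl⟩
      obtain ⟨c, hc, k, hk, rfl⟩ := hx
      refine ⟨c, hc, ?_⟩
      change f c = f (c * k)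
      rw [map_mul, (MonoidHom.mem_ker).mp hk, mul_one]
    · rintro ⟨x, hx, rfl⟩ ⟨c, hc, hcx⟩
      apply hx
      refine ⟨c, hc, c⁻¹ * x, ?_, by group⟩
      rw [SetLike.mem_coe, MonoidHom.mem_ker, map_mul, map_inv, hcx, inv_mul_cancel]
  rw [← isOpen_compl_iff, heq]
  exact hopen _ hS.isOpen_compl

end Kernel

/-! ### Generic levels on a compact `G` -/

section Generic

variable {G : Type u} [Group G] [TopologicalSpace G]
  {J : Type v} [Group J] [TopologicalSpace J] [IsTopologicalGroup J]
  (ρ : J →* TopOut G) {ι : Type w} [Nonempty ι] (N : ι → Subgroup G) (hdir : Directed (· ≥ ·) N)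
  (hinv : ∀ (i : ι) (e : outerSemidirectProduct ρ) (g : G), g ∈ N i → (e.1.1 : MulAut G) g ∈ N i)

/-- **`ι : G → G ⋊^out J` is a CLOSED EMBEDDING for COMPACT centre-free `G`** (levels normal,
neighbourhoods of `1`, separating points; `J` Hausdorff): a continuous injection from a compact space
to a Hausdorff space. [cite: MochizukiSemiAnbd2006, §0 p.5] -/
theorem isClosedEmbedding_toOuterSemidirectProduct_of_compact [IsTopologicalGroup G] [CompactSpace G]
    [T1Space G] [T2Space J] (hnormal : ∀ i, (N i).Normal)
    (hnhds : ∀ i, ((N i : Subgroup G) : Set G) ∈ 𝓝 (1 : G))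
    (hbasis : ∀ U ∈ 𝓝 (1 : G), ∃ i, ((N i : Subgroup G) : Set G) ⊆ U) (hZ : Subgroup.center G = ⊥) :
    @IsClosedEmbedding G (outerSemidirectProduct ρ) _ (topology ρ N hdir hinv)
      (toOuterSemidirectProduct ρ) := by
  letI := topology ρ N hdir hinv
  haveI := t2Space_of ρ N hdir hinv hbasis
  exact (continuous_toOuterSemidirectProduct ρ N hdir hinv hnormal hnhds).isClosedEmbedding
    (toOuterSemidirectProduct_injective ρ hZ)

omit [TopologicalSpace J] [IsTopologicalGroup J] [Nonempty ι] in
/-- `ker aug = ι(G)` as sets (algebraic exactness, abc-iut-w4-d082's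
`range_toOuterSemidirectProduct_eq_ker`). [cite: MochizukiSemiAnbd2006, §0 p.5] -/
theorem coe_ker_snd_eq_range [IsTopologicalGroup G] :
    ((outerSemidirectProductSnd ρ).ker : Set (outerSemidirectProduct ρ)) =
      Set.range (toOuterSemidirectProduct ρ) := by
  rw [← range_toOuterSemidirectProduct_eq_ker, MonoidHom.coe_range]

/-- **`ker aug` is COMPACT** for compact `G` (levels normal neighbourhoods of `1`).
[cite: MochizukiSemiAnbd2006, §0 p.5] -/
theorem isCompact_ker [IsTopologicalGroup G] [CompactSpace G] (hnormal : ∀ i, (N i).Normal)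
    (hnhds : ∀ i, ((N i : Subgroup G) : Set G) ∈ 𝓝 (1 : G)) :
    @IsCompact (outerSemidirectProduct ρ) (topology ρ N hdir hinv) (outerSemidirectProductSnd ρ).ker := by
  letI := topology ρ N hdir hinv
  rw [coe_ker_snd_eq_range]
  exact isCompact_range (continuous_toOuterSemidirectProduct ρ N hdir hinv hnormal hnhds)

/-- **`aug : G ⋊^out J → J` is a CLOSED map** for compact `G` under the continuity of the outer action
along the levels (it is open with compact kernel). [cite: MochizukiSemiAnbd2006, §0 p.5] -/
theorem isClosedMap_snd_of_levels [IsTopologicalGroup G] [CompactSpace G] (hnormal : ∀ i, (N i).Normal)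
    (hnhds : ∀ i, ((N i : Subgroup G) : Set G) ∈ 𝓝 (1 : G))
    (hcont : ∀ i, {j : J | ∃ e : outerSemidirectProduct ρ,
      (∀ g : G, g⁻¹ * (e.1.1 : MulAut G) g ∈ N i) ∧ e.1.2 = j} ∈ 𝓝 (1 : J)) :
    @IsClosedMap (outerSemidirectProduct ρ) J (topology ρ N hdir hinv) _ (outerSemidirectProductSnd ρ) := by
  letI := topology ρ N hdir hinv
  haveI := isTopologicalGroup ρ N hdir hinv
  exact isClosedMap_of_isOpenMap_of_isCompact_ker (outerSemidirectProductSnd ρ)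
    (outerSemidirectProductSnd_surjective ρ) (isOpenMap_snd_of_levels ρ N hdir hinv hcont)
    (isCompact_ker ρ N hdir hinv hnormal hnhds)

/-- **`aug : G ⋊^out J → J` is PROPER** for compact `G` under the continuity of the outer action:
continuous, closed, with fibres the translates of the compact kernel. [cite: MochizukiSemiAnbd2006, §0 p.5] -/
theorem isProperMap_snd_of_levels [IsTopologicalGroup G] [CompactSpace G] (hnormal : ∀ i, (N i).Normal)
    (hnhds : ∀ i, ((N i : Subgroup G) : Set G) ∈ 𝓝 (1 : G))
    (hcont : ∀ i, {j : J | ∃ e : outerSemidirectProduct ρ,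
      (∀ g : G, g⁻¹ * (e.1.1 : MulAut G) g ∈ N i) ∧ e.1.2 = j} ∈ 𝓝 (1 : J)) :
    @IsProperMap (outerSemidirectProduct ρ) J (topology ρ N hdir hinv) _ (outerSemidirectProductSnd ρ) := by
  letI := topology ρ N hdir hinv
  haveI := isTopologicalGroup ρ N hdir hinv
  refine isProperMap_iff_isClosedMap_and_compact_fibers.mpr ⟨continuous_snd ρ N hdir hinv,
    isClosedMap_snd_of_levels ρ N hdir hinv hnormal hnhds hcont, fun j => ?_⟩
  obtain ⟨x, hx⟩ := outerSemidirectProductSnd_surjective ρ j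
  rw [preimage_singleton_eq_image_ker (outerSemidirectProductSnd ρ) hx]
  exact (isCompact_ker ρ N hdir hinv hnormal hnhds).image (continuous_const_mul x)

/-- **`G ⋊^out J` is COMPACT for compact `G` and compact `J`** under the continuity of the outer action
along the levels: `G ⋊^out J = aug⁻¹(J)` with `aug` proper.  (No inverse limits, no completeness of
`Aut(G)`.) [cite: DixonEtAl1999, Thm 5.3] -/
theorem compactSpace_of_levels [IsTopologicalGroup G] [CompactSpace G] [CompactSpace J]
    (hnormal : ∀ i, (N i).Normal) (hnhds : ∀ i, ((N i : Subgroup G) : Set G) ∈ 𝓝 (1 : G))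
    (hcont : ∀ i, {j : J | ∃ e : outerSemidirectProduct ρ,
      (∀ g : G, g⁻¹ * (e.1.1 : MulAut G) g ∈ N i) ∧ e.1.2 = j} ∈ 𝓝 (1 : J)) :
    @CompactSpace (outerSemidirectProduct ρ) (topology ρ N hdir hinv) := by
  letI := topology ρ N hdir hinv
  have h := (isProperMap_snd_of_levels ρ N hdir hinv hnormal hnhds hcont).isCompact_preimage
    isCompact_univ
  rw [Set.preimage_univ] at h
  exact isCompact_univ_iff.mp h

/-- **`G ⋊^out J` is TOTALLY DISCONNECTED** when `J` is profinite and the levels separate the points of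
the `T₁` group `G`: the level sets `levelNhd (N i) U` at open subgroups `U ≤ J` are clopen subgroups and
their cosets separate points. [cite: DixonEtAl1999, Thm 5.3] -/
theorem totallyDisconnectedSpace_of [T1Space G] [T2Space J] [CompactSpace J] [TotallyDisconnectedSpace J]
    (hbasis : ∀ U ∈ 𝓝 (1 : G), ∃ i, ((N i : Subgroup G) : Set G) ⊆ U) :
    @TotallyDisconnectedSpace (outerSemidirectProduct ρ) (topology ρ N hdir hinv) := by
  letI := topology ρ N hdir hinv
  haveI := isTopologicalGroup ρ N hdir hinv
  haveI := t2Space_of ρ N hdir hinv hbasis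
  rw [totallyDisconnectedSpace_iff_connectedComponent_singleton]
  intro x
  refine Set.eq_singleton_iff_unique_mem.mpr ⟨mem_connectedComponent, fun y hy => ?_⟩
  by_contra hne
  have hz : x⁻¹ * y ≠ 1 := fun h => hne (inv_mul_eq_one.mp h).symm
  -- a basic identity neighbourhood missing `x⁻¹ y`, shrunk to an open subgroup of `J`
  obtain ⟨⟨i, V⟩, hV, hzV⟩ :=
    (hasBasis_nhds_one ρ N hdir hinv).mem_iff.mp (compl_singleton_mem_nhds hz.symm)
  obtain ⟨W, hWV, hW, h1W⟩ := mem_nhds_iff.mp hV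
  obtain ⟨U, hU⟩ := ProfiniteGrp.exist_openNormalSubgroup_sub_open_nhds_of_one hW h1W
  let S : Subgroup (outerSemidirectProduct ρ) :=
    { carrier := levelNhd ρ (N i) (U : Set J)
      one_mem' := one_mem_levelNhd ρ (N i) U.one_mem'
      mul_mem' := fun {e f} he hf =>
        ⟨fun g => congr_mul he.1 hf.1 (hinv i e) g, U.mul_mem' he.2 hf.2⟩
      inv_mem' := fun {e} he => ⟨fun g => congr_inv he.1 g, U.inv_mem' he.2⟩ }
  have hS1 : (S : Set (outerSemidirectProduct ρ)) ∈ 𝓝 (1 : outerSemidirectProduct ρ) :=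
    levelNhd_mem_nhds_one ρ N hdir hinv i (U.isOpen'.mem_nhds U.one_mem')
  have hSopen : IsOpen (S : Set (outerSemidirectProduct ρ)) := S.isOpen_of_mem_nhds hS1
  have hzS : x⁻¹ * y ∉ S := fun h =>
    hzV (levelNhd_mono ρ le_rfl (fun j hj => hWV (hU hj)) h) rfl
  have hclopen : IsClopen ((fun t => x * t) '' (S : Set (outerSemidirectProduct ρ))) :=
    ⟨(Homeomorph.mulLeft x).isClosed_image.mpr (S.isClosed_of_isOpen hSopen),
      (Homeomorph.mulLeft x).isOpen_image.mpr hSopen⟩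
  have hx : x ∈ (fun t => x * t) '' (S : Set (outerSemidirectProduct ρ)) := ⟨1, S.one_mem, mul_one x⟩
  obtain ⟨t, ht, hty⟩ := hclopen.connectedComponent_subset hx hy
  apply hzS
  have : x⁻¹ * y = t := by rw [← hty]; group
  rw [this]
  exact ht

end Generic

/-! ### The characteristic levels of a profinite, topologically finitely generated `G` -/

section CharOpenCore

variable {G : Type u} [Group G] [TopologicalSpace G]
  {J : Type v} [Group J] [TopologicalSpace J] (ρ : J →* TopOut G)

omit [TopologicalSpace J] in
/-- The characteristic open cores are a DIRECTED (antitone) family of levels.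
[cite: DixonEtAl1999, Prop 1.6] -/
theorem charOpenCore_directed : Directed (· ≥ ·) (charOpenCore G) := fun i j =>
  ⟨max i j, charOpenCore_anti (le_max_left i j), charOpenCore_anti (le_max_right i j)⟩

omit [TopologicalSpace J] in
/-- The characteristic open cores are INVARIANT under the outer action (every element of `G ⋊^out J`
acts on `G` through a bi-continuous automorphism; abc-iut-w4-d053). [cite: DixonEtAl1999, Prop 1.6] -/
theorem charOpenCore_outerInvariant :
    ∀ (d : ℕ) (e : outerSemidirectProduct ρ) (g : G),
      g ∈ charOpenCore G d → (e.1.1 : MulAut G) g ∈ charOpenCore G d :=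
  fun d e _ hg => outerSemidirectProduct_fst_apply_mem_charOpenCore ρ d e hg

omit [TopologicalSpace J] in
/-- In a topologically finitely generated group the characteristic open cores are neighbourhoods of `1`.
[cite: DixonEtAl1999, Prop 1.6] -/
theorem charOpenCore_mem_nhds_one [IsTopologicalGroup G] (hG : IsTopologicallyFinitelyGenerated G)
    (d : ℕ) : ((charOpenCore G d : Subgroup G) : Set G) ∈ 𝓝 (1 : G) :=
  (isOpen_charOpenCore_of_tfg hG d).mem_nhds (one_mem _)

omit [TopologicalSpace J] in
/-- In a PROFINITE group the characteristic open cores are COFINAL in the neighbourhoods of `1` (every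
neighbourhood contains an open normal subgroup, of finite index by compactness, which contains the core
of its index). [cite: DixonEtAl1999, Prop 1.6] -/
theorem exists_charOpenCore_subset [IsTopologicalGroup G] [CompactSpace G] [TotallyDisconnectedSpace G] :
    ∀ U ∈ 𝓝 (1 : G), ∃ d : ℕ, ((charOpenCore G d : Subgroup G) : Set G) ⊆ U := by
  intro U hU
  obtain ⟨W, hWU, hW, h1⟩ := mem_nhds_iff.mp hU
  obtain ⟨H, hH⟩ := ProfiniteGrp.exist_openNormalSubgroup_sub_open_nhds_of_one hW h1
  haveI : (H : Subgroup G).FiniteIndex := Subgroup.finiteIndex_of_finite_quotient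
  exact ⟨(H : Subgroup G).index,
    fun g hg => hWU (hH (charOpenCore_le_of_finiteIndex (H : Subgroup G) H.isOpen' hg))⟩

/-- **The outer action is continuous along the characteristic levels as soon as every finite-index
subgroup of `J` is open** (e.g. `J` topologically finitely generated profinite, Nikolov–Segal): the
congruence set at the finite characteristic level `charOpenCore G d` is the kernel of the induced
`J → Out(G ⧸ charOpenCore G d)` (abc-iut-L3-d2's `TemperedExtension.exists_congruence_ker`), a
finite-index subgroup. [cite: MochizukiSemiAnbd2006, Prop 5.2 (i), p. 63] -/
theorem levels_continuous_of_finiteIndex_isOpen [IsTopologicalGroup G]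
    (hG : IsTopologicallyFinitelyGenerated G) (hfio : ∀ U : Subgroup J, U.FiniteIndex → IsOpen (U : Set J)) :
    ∀ d : ℕ, {j : J | ∃ e : outerSemidirectProduct ρ,
      (∀ g : G, g⁻¹ * (e.1.1 : MulAut G) g ∈ charOpenCore G d) ∧ e.1.2 = j} ∈ 𝓝 (1 : J) := by
  intro d
  haveI := charOpenCore_normal (Γ := G) d
  haveI := finiteIndex_charOpenCore_of_tfg hG d
  haveI : Finite (G ⧸ charOpenCore G d) := Subgroup.finite_quotient_of_finiteIndex
  have hstab : ∀ (a : J) (α : contMulAut G), TopOut.mk G α = ρ a →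
      (charOpenCore G d).map ((α : MulAut G) : G →* G) = charOpenCore G d :=
    fun _ α _ => map_charOpenCore_eq (α : MulAut G) α.2.1 α.2.2
  obtain ⟨C, hC, hmem⟩ := TemperedExtension.exists_congruence_ker ρ (charOpenCore G d) hstab
  refine Filter.mem_of_superset ((hfio C hC).mem_nhds C.one_mem) fun a ha => ?_
  obtain ⟨α, hα, hcong⟩ := (hmem a).mp ha
  refine ⟨⟨(α, a), hα⟩, fun g => ?_, rfl⟩
  -- `g⁻¹ α(g) = g⁻¹ (α(g) g⁻¹) g`
  have h := Subgroup.Normal.conj_mem' inferInstance _ (hcong g) g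
  simpa only [mul_assoc, inv_mul_cancel, mul_one] using h

/-- **SUMMARY — `G ⋊^out J` is a PROFINITE group along the characteristic levels**: for `G` profinite,
topologically finitely generated and centre-free, `J` profinite and the outer action continuous along
the levels `charOpenCore G d`, the topology `topology ρ (charOpenCore G) hdir hinv` is a compact
Hausdorff totally disconnected group topology, `ι : G → G ⋊^out J` is a closed embedding, `aug` is
continuous, open and surjective, `ι` is injective with `range ι = ker aug` — i.e. `1 → G → G ⋊^out J → J → 1`
is an exact sequence of profinite groups. [cite: MochizukiSemiAnbd2006, §0 p.5] -/
theorem exists_profinite_topology [IsTopologicalGroup G] [CompactSpace G] [TotallyDisconnectedSpace G]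
    [IsTopologicalGroup J] [CompactSpace J] [TotallyDisconnectedSpace J] [T2Space J]
    (hG : IsTopologicallyFinitelyGenerated G) (hZ : Subgroup.center G = ⊥)
    (hcont : ∀ d : ℕ, {j : J | ∃ e : outerSemidirectProduct ρ,
      (∀ g : G, g⁻¹ * (e.1.1 : MulAut G) g ∈ charOpenCore G d) ∧ e.1.2 = j} ∈ 𝓝 (1 : J)) :
    ∃ τ : TopologicalSpace (outerSemidirectProduct ρ),
      τ = topology ρ (charOpenCore G) charOpenCore_directed (charOpenCore_outerInvariant ρ) ∧
      @IsTopologicalGroup _ τ _ ∧ @CompactSpace _ τ ∧ @T2Space _ τ ∧ @TotallyDisconnectedSpace _ τ ∧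
      @IsClosedEmbedding _ _ _ τ (toOuterSemidirectProduct ρ) ∧
      @Continuous _ _ τ _ (outerSemidirectProductSnd ρ) ∧
      @IsOpenMap _ _ τ _ (outerSemidirectProductSnd ρ) ∧
      Function.Injective (toOuterSemidirectProduct ρ) ∧
      (toOuterSemidirectProduct ρ).range = (outerSemidirectProductSnd ρ).ker ∧
      Function.Surjective (outerSemidirectProductSnd ρ) := by
  haveI : T1Space G := inferInstance
  have hnormal : ∀ d, (charOpenCore G d).Normal := charOpenCore_normal
  refine ⟨_, rfl, isTopologicalGroup ρ _ _ _,
    compactSpace_of_levels ρ _ _ _ hnormal (charOpenCore_mem_nhds_one hG) hcont,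
    t2Space_of ρ _ _ _ exists_charOpenCore_subset,
    totallyDisconnectedSpace_of ρ _ _ _ exists_charOpenCore_subset,
    isClosedEmbedding_toOuterSemidirectProduct_of_compact ρ _ _ _ hnormal (charOpenCore_mem_nhds_one hG)
      exists_charOpenCore_subset hZ,
    continuous_snd ρ _ _ _, isOpenMap_snd_of_levels ρ _ _ _ hcont,
    toOuterSemidirectProduct_injective ρ hZ, range_toOuterSemidirectProduct_eq_ker ρ,
    outerSemidirectProductSnd_surjective ρ⟩

end CharOpenCore

/-! ### Necessity of the continuity hypothesis -/

section Necessity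

variable {G : Type u} [Group G] [TopologicalSpace G]
  {J : Type v} [Group J] [TopologicalSpace J] [IsTopologicalGroup J]
  (ρ : J →* TopOut G) {ι : Type w} [Nonempty ι] (N : ι → Subgroup G) (hdir : Directed (· ≥ ·) N)
  (hinv : ∀ (i : ι) (e : outerSemidirectProduct ρ) (g : G), g ∈ N i → (e.1.1 : MulAut G) g ∈ N i)

/-- **The continuity of the outer action along the levels is NECESSARY for compactness**: if the level
topology on `G ⋊^out J` is compact and `J` is Hausdorff, then for every level `i` the congruence set
`{j | some e over j has first component ≡ 1 mod N i}` is a neighbourhood of `1` in `J` — it is the image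
under `aug` of the open level subgroup at `V = J`, and `aug`, a closed continuous surjective
homomorphism from a compact group, is a quotient map, hence open.  Together with
`compactSpace_of_levels` (for compact `G`, `J`): `hcont` ⟺ `G ⋊^out J` compact.
[cite: DixonEtAl1999, §5.2] -/
theorem levels_continuous_of_compactSpace [T2Space J]
    (hc : @CompactSpace (outerSemidirectProduct ρ) (topology ρ N hdir hinv)) :
    ∀ i, {j : J | ∃ e : outerSemidirectProduct ρ,
      (∀ g : G, g⁻¹ * (e.1.1 : MulAut G) g ∈ N i) ∧ e.1.2 = j} ∈ 𝓝 (1 : J) := by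
  letI := topology ρ N hdir hinv
  haveI := isTopologicalGroup ρ N hdir hinv
  haveI := hc
  intro i
  have hcont := continuous_snd ρ N hdir hinv
  have hq : IsQuotientMap (outerSemidirectProductSnd ρ) :=
    hcont.isClosedMap.isQuotientMap hcont (outerSemidirectProductSnd_surjective ρ)
  -- a quotient homomorphism is open: the saturation of an open set is a union of right translates
  have hopen : IsOpenMap (outerSemidirectProductSnd ρ) := by
    intro O hO
    rw [← hq.isOpen_preimage]
    have heq : outerSemidirectProductSnd ρ ⁻¹' (outerSemidirectProductSnd ρ '' O) =
        ⋃ k ∈ ((outerSemidirectProductSnd ρ).ker : Set (outerSemidirectProduct ρ)),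
          (fun y => y * k) '' O := by
      ext y
      simp only [Set.mem_preimage, Set.mem_image, Set.mem_iUnion, SetLike.mem_coe, MonoidHom.mem_ker,
        exists_prop]
      constructor
      · rintro ⟨x, hx, hxy⟩
        refine ⟨x⁻¹ * y, ?_, x, hx, by group⟩
        rw [map_mul, map_inv, hxy, inv_mul_cancel]
      · rintro ⟨k, hk, x, hx, rfl⟩
        exact ⟨x, hx, by rw [map_mul, hk, mul_one]⟩
    rw [heq]
    exact isOpen_biUnion fun k _ => (Homeomorph.mulRight k).isOpen_image.mpr hO
  let S : Subgroup (outerSemidirectProduct ρ) :=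
    { carrier := levelNhd ρ (N i) Set.univ
      one_mem' := one_mem_levelNhd ρ (N i) (Set.mem_univ _)
      mul_mem' := fun {e f} he hf =>
        ⟨fun g => congr_mul he.1 hf.1 (hinv i e) g, Set.mem_univ _⟩
      inv_mem' := fun {e} he => ⟨fun g => congr_inv he.1 g, Set.mem_univ _⟩ }
  have hSopen : IsOpen (S : Set (outerSemidirectProduct ρ)) :=
    S.isOpen_of_mem_nhds (levelNhd_mem_nhds_one ρ N hdir hinv i Filter.univ_mem)
  have himage : outerSemidirectProductSnd ρ '' (S : Set (outerSemidirectProduct ρ)) =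
      {j : J | ∃ e : outerSemidirectProduct ρ, (∀ g : G, g⁻¹ * (e.1.1 : MulAut G) g ∈ N i) ∧ e.1.2 = j} := by
    ext j
    exact ⟨fun ⟨e, he, hj⟩ => ⟨e, he.1, hj⟩, fun ⟨e, he, hj⟩ => ⟨e, ⟨he, Set.mem_univ _⟩, hj⟩⟩
  rw [← himage]
  exact ((hopen _ hSopen).mem_nhds ⟨1, S.one_mem, map_one _⟩)

end Necessity

end outerSemidirectProduct

end Literature.AnabelianGeometry.SemiGraphs
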